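import Summits.QuantumFields.BalabanUV.T4Continuum.Support.BalabanAveragedTowerModes
import Mathlib.Analysis.SpecialFunctions.Trigonometric.Bounds

/-!
# T⁴ programme, spine node NE2 (U1a) — lattice trigonometry for `x`-dependent witnesses: the profile `cos(2π·val(a)/m)` on `ZMod m`
# under ONE LATTICE STEP (`≤ 2π/m`, torus wrap-around included) and under THE BLOCK PARENT (`≤ 2π/(n·M)`, because the blocks nest)

NE2 formalisation swarm `b2b-balaban-t4-ne2-formalise-*`, leaf prover 03 (row B5 lineage; support row «B7.w END WITNESS», supplier of the third
file `Spine/NE2BalabanWaveWitness`).  The `x`-dependent witness background reads the smooth `1`-periodic profile `cos(2π·pos/M_{μ₀})` of the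
PHYSICAL coordinate `pos = val(x_{μ₀})/n` on each lattice of the tower; its lattice-Lipschitz size and its two-level (parent∕child) consistency
come from the two elementary facts below:
 * `cang m a := cos(2π·val(a)/m)`, `abs_cang_le`, `cang_add` (addition in `ZMod m` shifts the angle by the summand's angle modulo `2π`),
   **`abs_cang_add_one_sub_le`**: `|c(a + 1) − c(a)| ≤ 2π/m`;
 * **`abs_cang_sub_cang_par_le`**: for a fine site `x′` (lattice number `L·n`) and its block parent `par x′` (lattice number `n`; the owner's
   `BalabanAveragedTowerModes.val_par`: `val(par x′)_{μ₀} = ⌊val(x′_{μ₀})/L⌋`), `|c_{L·n·M}(x′_{μ₀}) − c_{n·M}((par x′)_{μ₀})| ≤ 2π/(n·M_{μ₀})`.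

HONEST FRAMING (T4-DAG p. 1).  Elementary (`|cos a − cos b| ≤ |a − b|`, `Nat.mod_add_div`); OURS; no physics; NE2 NOT proved; spine 0/9; NOT
infinite volume ∕ mass gap ∕ Clay.  HONEST DEPENDENCY: continuum YM on T⁴ ⇐ BetaPertH ∧ nine spine estimates (0/9 proved); BetaPertH ⇐ (D1) ∧
(D4) ∧ CAP+tail; G-an2-4 gates asym, D1 and NE2/3/4.  ABSOLUTE RULE kept; no `sorry`.
-/

noncomputable section

open Real

namespace Summit.QuantumFields.BalabanUV.T4Continuum.LatticeCosineProfile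

open Literature.MathematicalPhysics.QuantumFieldTheory.Balaban1983to89.B5Prop11Plancherel (Tor fine)
open Summit.QuantumFields.BalabanUV.T4Continuum.BalabanAveragedTowerModes (par val_par)


/-- the lattice cosine profile `c(a) = cos(2π·val(a)/m)` on `ZMod m` (a smooth `1`-periodic function of the physical coordinate `val(a)/n` read
on the lattice of spacing `1/n`, `m = n·M`). [folklore] -/
def cang (m : ℕ) (a : ZMod m) : ℝ := Real.cos (2 * π * (a.val : ℝ) / m)

/-- `|c| ≤ 1`. [folklore] -/
theorem abs_cang_le (m : ℕ) (a : ZMod m) : |cang m a| ≤ 1 := Real.abs_cos_le_one _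

/-- addition in `ZMod m` shifts the angle by a multiple of `2π` plus the summand's angle (torus wrap-around absorbed by periodicity). [folklore] -/
theorem cang_add (m : ℕ) [NeZero m] (a b : ZMod m) :
    cang m (a + b) = Real.cos (2 * π * ((a.val + b.val : ℕ) : ℝ) / m) := by
  have hm : (m : ℝ) ≠ 0 := by exact_mod_cast NeZero.ne m
  set s : ℕ := a.val + b.val with hs
  have hdiv : ((s % m : ℕ) : ℝ) = (s : ℝ) - (m : ℝ) * ((s / m : ℕ) : ℝ) := by
    have h := Nat.mod_add_div s m
    have h' : ((s % m : ℕ) : ℝ) + (m : ℝ) * ((s / m : ℕ) : ℝ) = (s : ℝ) := by exact_mod_cast h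
    linarith
  unfold cang
  rw [ZMod.val_add, ← hs]
  have e : 2 * π * ((s % m : ℕ) : ℝ) / m = 2 * π * (s : ℝ) / m - ((s / m : ℕ) : ℝ) * (2 * π) := by
    rw [hdiv]; field_simp
  rw [e, Real.cos_sub_nat_mul_two_pi]

/-- one step of `b` changes the profile by at most `2π·val(b)/m`. [folklore] -/
theorem abs_cang_add_sub_le (m : ℕ) [NeZero m] (a b : ZMod m) :
    |cang m (a + b) - cang m a| ≤ 2 * π * (b.val : ℝ) / m := by
  have hm : (0 : ℝ) < m := by exact_mod_cast Nat.pos_of_ne_zero (NeZero.ne m)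
  rw [cang_add]
  unfold cang
  refine (Real.abs_cos_sub_cos_le _ _).trans (le_of_eq ?_)
  rw [Nat.cast_add]
  have e : 2 * π * ((a.val : ℝ) + (b.val : ℝ)) / m - 2 * π * (a.val : ℝ) / m = 2 * π * (b.val : ℝ) / m := by ring
  rw [e, abs_of_nonneg (by positivity)]

/-- **ONE LATTICE STEP** moves the profile by at most `2π/m`. [folklore] -/
theorem abs_cang_add_one_sub_le (m : ℕ) [NeZero m] (a : ZMod m) : |cang m (a + 1) - cang m a| ≤ 2 * π / m := by
  have hm : (0 : ℝ) < m := by exact_mod_cast Nat.pos_of_ne_zero (NeZero.ne m)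
  refine (abs_cang_add_sub_le m a 1).trans ?_
  have h1 : ((1 : ZMod m).val : ℝ) ≤ 1 := by
    rw [ZMod.val_one_eq_one_mod]; exact_mod_cast Nat.mod_le 1 m
  calc 2 * π * ((1 : ZMod m).val : ℝ) / m ≤ 2 * π * 1 / m := by gcongr
    _ = 2 * π / m := by rw [mul_one]

variable {d : ℕ} (L : ℕ) [NeZero L] (M : Fin d → ℕ) [hM : ∀ μ, NeZero (M μ)]

/-- **THE BLOCK PARENT MOVES THE PROFILE BY AT MOST `2π/(n·M_{μ₀})`**: for a fine site `x′` (lattice number `L·n`) and its parent `par x′`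
(lattice number `n`; `val(par x′)_{μ₀} = ⌊val(x′_{μ₀})/L⌋`, the owner's `val_par`), the profiles read on the two lattices differ by less than one
coarse step — BECAUSE the blocks nest. [folklore] -/
theorem abs_cang_sub_cang_par_le (n : ℕ) [NeZero n] (x' : Tor (fine (L * n) M)) (μ₀ : Fin d) :
    |cang (fine (L * n) M μ₀) (x' μ₀) - cang (fine n M μ₀) (par n L M x' μ₀)| ≤ 2 * π / ((n : ℝ) * M μ₀) := by
  have hL : (0 : ℝ) < L := by exact_mod_cast Nat.pos_of_ne_zero (NeZero.ne L)
  have hn : (0 : ℝ) < n := by exact_mod_cast Nat.pos_of_ne_zero (NeZero.ne n)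
  have hMμ : (0 : ℝ) < M μ₀ := by exact_mod_cast Nat.pos_of_ne_zero (NeZero.ne (M μ₀))
  have hLn : 0 < L := Nat.pos_of_ne_zero (NeZero.ne L)
  set v : ℕ := (x' μ₀).val with hv
  have hpar : (par n L M x' μ₀).val = v / L := by rw [val_par]
  -- `v = L·q + r`, `q = ⌊v/L⌋`, `0 ≤ r < L`
  have hqr : ((v % L : ℕ) : ℝ) + (L : ℝ) * ((v / L : ℕ) : ℝ) = (v : ℝ) := by exact_mod_cast Nat.mod_add_div v L
  have hr : ((v % L : ℕ) : ℝ) < L := by exact_mod_cast Nat.mod_lt v hLn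
  have hr0 : (0 : ℝ) ≤ ((v % L : ℕ) : ℝ) := Nat.cast_nonneg _
  unfold cang
  rw [hpar]
  have e1 : ((fine (L * n) M μ₀ : ℕ) : ℝ) = (L : ℝ) * n * M μ₀ := by simp only [fine]; push_cast; ring
  have e2 : ((fine n M μ₀ : ℕ) : ℝ) = (n : ℝ) * M μ₀ := by simp only [fine]; push_cast; ring
  rw [e1, e2]
  refine (Real.abs_cos_sub_cos_le _ _).trans ?_
  have e3 : 2 * π * (v : ℝ) / ((L : ℝ) * n * M μ₀) - 2 * π * ((v / L : ℕ) : ℝ) / ((n : ℝ) * M μ₀)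
      = (2 * π / ((n : ℝ) * M μ₀)) * (((v % L : ℕ) : ℝ) / L) := by
    rw [← hqr]; field_simp; ring
  rw [e3, abs_of_nonneg (by positivity)]
  calc 2 * π / ((n : ℝ) * M μ₀) * (((v % L : ℕ) : ℝ) / L) ≤ 2 * π / ((n : ℝ) * M μ₀) * 1 := by
        refine mul_le_mul_of_nonneg_left ((div_le_one hL).mpr hr.le) (by positivity)
    _ = 2 * π / ((n : ℝ) * M μ₀) := mul_one _

end Summit.QuantumFields.BalabanUV.T4Continuum.LatticeCosineProfile

end
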